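import Literature.NumberTheory.LFunctions.NymanBeurlingRateJ
import Literature.NumberTheory.LFunctions.NymanBeurlingRateInvZetaApprox
import Literature.NumberTheory.LFunctions.NymanBeurlingRateZetaHalf
import HarnessLib

/-!
# Balazard–de Roton 2010, Théorème 1: the theorem from its two deep inputs

Topic `Literature/NumberTheory/LFunctions`; assembly file for the named fact
`Literature.NumberTheory.LFunctions.BalazardDeRoton2010_thm1` (`NymanBeurlingRate.lean`): under RH,
`d_N² ≪_δ (log log N)^{5/2+δ}(log N)^{-1/2}` (M. Balazard, A. de Roton, Int. J. Number Theory 6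
(2010) 883–903 = arXiv:0812.1689, Théorème 1).

Everything of the printed proof that is NOT Soundararajan's method for `M(x)` is proved in the tree:

* Prop. 1 and the `ε`-choice — `NymanBeurlingRateReduction.lean` (`BalazardDeRoton2010_thm1_of_props`);
* Prop. 4 (i)(ii) — `ZetaShiftRatioRH.lean`, `GammaShiftRatioSharp.lean`, `ZetaShiftRatioBounds.lean`;
* Prop. 5, Prop. 2 (`J_ε ≪ ε`) — `NymanBeurlingRateResidue.lean`, `NymanBeurlingRateJ.lean`;
* Prop. 13 — `NymanBeurlingRateLargeOrdinates.lean`; Prop. 14, Prop. 3 — `NymanBeurlingRateSmallOrdinates.lean`;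
* eq. (t61), Prop. 11 — `NymanBeurlingRateMoebiusTail.lean`; Prop. 10 — `NymanBeurlingRateInvZetaApprox.lean`;
* Titchmarsh (14.14.1) under RH and the input `|ζ(½+iτ)|² ≤ K'(1+|τ|)^{β(τ)}` of Prop. 14 —
  `ZetaCriticalLineRHBound.lean`, `NymanBeurlingRateZetaHalf.lean`.

`BalazardDeRoton2010_thm1_of_deep` states Théorème 1 as a consequence of exactly two inputs, both
"(HR)" statements of the literature obtained by Soundararajan's method, that remain to be formalized:

* (A) `M(x) ≪ √x exp((log x)^{1/2}(log log x)^{5/2+δ})` under RH — K. Soundararajan, *Partial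
  sums of the Möbius function*, J. reine angew. Math. 631 (2009), Thm. 1 (with `(log log x)^{14}`),
  exponent `5/2+δ` by M. Balazard, A. de Roton, arXiv:0810.3587;
* (P12) Balazard–de Roton's Proposition 12 (twisted sums `M_N(iτ)`, §6.2, same method).

The unconditional discharge `BalazardDeRoton2010_thm1_holds` awaits proofs of (A) and (P12).

## References

* [BalazardDeRoton2010] M. Balazard, A. de Roton, Int. J. Number Theory 6 (2010) 883–903, Théorème 1
  and Props. 1–14 (arXiv:0812.1689).
* [Titchmarsh1986] E. C. Titchmarsh, *The Theory of the Riemann Zeta-Function*, 2nd ed., Thm. 14.14 (A).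
-/

noncomputable section

open Complex

namespace Literature.NumberTheory.LFunctions

open BalazardDeRoton BaezDuarteOnlyIf

/-- **Balazard–de Roton 2010, Théorème 1, from its deep inputs (A), (P12)** (see the module
docstring; `gFun p x = exp((log x)^{1/2}(log log x)^p)`, `eExp`, `kappaExp` as in the paper).
[cite: BalazardDeRoton2010, Théorème 1] -/
theorem BalazardDeRoton2010_thm1_of_deep
    (hA : RiemannHypothesis → ∀ δ : ℝ, 0 < δ → δ ≤ 1 / 2 → ∃ C : ℝ, 0 < C ∧ ∀ x : ℝ, 3 ≤ x →
      |(mertensFunction x : ℝ)| ≤ C * Real.sqrt x * gFun (5 / 2 + δ) x)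
    (h12 : RiemannHypothesis → ∀ δ : ℝ, 0 < δ → δ ≤ 1 / 12 → ∃ (N₀ : ℕ) (K : ℝ), 0 < K ∧
      ∀ N : ℕ, N₀ ≤ N → ∀ τ : ℝ, Real.exp (3 * eExp (5 / 2 + 6 * δ) N) ≤ |τ| →
        |τ| ≤ (N : ℝ) ^ (3 / 4 : ℝ) →
        ‖moebiusSum N (τ * I)‖ ≤ K * Real.sqrt N * |τ| ^ (1 / 2 - kappaExp τ)) :
    BalazardDeRoton2010_thm1 :=
  BalazardDeRoton2010_thm1_of_props
    (fun hRH ↦ exists_lintegral_jIntegrand_le hRH)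
    (fun hRH ↦ iBound_of_pointwise hRH (invZetaApprox_of_deep hRH (hA hRH) (h12 hRH))
      (exists_norm_sq_zeta_half_le_rpow_betaExp hRH))

end Literature.NumberTheory.LFunctions

end
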